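import Literature.Analysis.OperatorTheory.SobolevPointBound
import Mathlib.Analysis.Calculus.ContDiff.Comp
import Mathlib.Analysis.Calculus.BumpFunction.FiniteDimension
import Mathlib.Analysis.SpecificLimits.Normed
import HarnessLib

/-!
# From a smooth frame to the Sobolev point bound: values through `L²`-norms of frame words

Sequel of `Literature.Analysis.OperatorTheory.SobolevPointBound`. For finitely many vector fields
`(V_p)_{p < d}` smooth on a ball of `ℝ^d = Fin d → ℝ` whose frame map at `0` is invertible (a
frame near `0` — in the application, the coordinate expression of the left-invariant vector
fields of a basis of the Lie algebra in an exponential chart), this file converts iterated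
Fréchet derivatives into words of derivatives along the frame and concludes the point bound
through `L²`-norms of frame words:

* `vfWord Vf l F` — the word `V_{p₁} (⋯ (V_{pₖ} F))` of a list (first letter outermost, as
  `wordEnd` of `NelsonAPrioriEstimate`), `vfWord_append_singleton`, `contDiffOn_vfWord`;
* `frameMap Vf y : v ↦ ∑ v_p V_p(y)`, `exists_coframeRadius` — a radius on which `Φ(y)` is
  invertible with smooth inverse `Ψ = Ring.inverse ∘ Φ` (`contDiffAt_ringInverse`), and the
  expansion `DF(y)[v] = ∑_p (Ψ(y) v)_p (V_p F)(y)` (`fderiv_apply_eq_sum_coframe`);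
* `wordSum Vf j F x = ∑_{k ≤ j} ∑_{w : Fin k → Fin d} ‖(V_w F)(x)‖` and
  `exists_norm_iteratedFDerivWithin_le_wordSum` — **`‖D^i F (x)‖ ≤ C S_i(F, x)`** on a compact
  ball for all functions smooth on the open ball (induction on the order: Leibniz within the
  ball, `‖D^i (Ψ v)_p‖ ≤ ‖v‖ sup ‖D^i Ψ‖`, and the re-indexing `S_j(V_p F) ≤ S_{j+1}(F)`);
* `exists_frame_pointBound` — **`‖F 0‖ ≤ C ∑_{k ≤ d} ∑_w (∫_{‖x‖ ≤ ρ} ‖(V_w F)(x)‖² dx)^{1/2}`**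
  for every smooth `F` and every small `ρ` (a bump function, `exists_norm_apply_zero_le_sum_setIntegral`,
  the conversion, Cauchy–Schwarz).

Everything here is proved; the definitions are `vfWord`, `frameMap`, `wordSum`.

## References

* E. Nelson, *Analytic vectors*, Ann. of Math. 70 (1959), §6 [Nelson1959] (not held).
* R. A. Adams, *Sobolev Spaces* (1975), Thm. 5.4 Part I Case C [Adams1975].
-/

open scoped ContDiff Topology ENNReal
open MeasureTheory Set Filter Finset Metric

noncomputable section

namespace Literature.Analysis.OperatorTheory

variable {d : ℕ}

/-! ## 1. Words of derivatives along vector fields -/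

section Words

variable {κ : Type*}

/-- The word `V_{p₁} (V_{p₂} (⋯ (V_{pₖ} F)))` of derivatives along the vector fields `V_p` of a
list `[p₁, …, pₖ]` (the first letter outermost): `(V_p F)(x) = DF(x)[V_p(x)]`. [folklore] -/
def vfWord (Vf : κ → (Fin d → ℝ) → (Fin d → ℝ)) : List κ → ((Fin d → ℝ) → ℂ) → ((Fin d → ℝ) → ℂ)
  | [], F => F
  | p :: l, F => fun x ↦ fderiv ℝ (vfWord Vf l F) x (Vf p x)

variable (Vf : κ → (Fin d → ℝ) → (Fin d → ℝ))

/-- `vfWord [] F = F`. [folklore] -/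
@[simp] theorem vfWord_nil (F : (Fin d → ℝ) → ℂ) : vfWord Vf [] F = F := rfl

/-- `vfWord (p :: l) F = V_p (vfWord l F)`. [folklore] -/
theorem vfWord_cons (p : κ) (l : List κ) (F : (Fin d → ℝ) → ℂ) :
    vfWord Vf (p :: l) F = fun x ↦ fderiv ℝ (vfWord Vf l F) x (Vf p x) := rfl

/-- `vfWord (l ++ [p]) F = vfWord l (V_p F)`: the last letter acts first. [folklore] -/
theorem vfWord_append_singleton (l : List κ) (p : κ) (F : (Fin d → ℝ) → ℂ) :
    vfWord Vf (l ++ [p]) F = vfWord Vf l (vfWord Vf [p] F) := by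
  induction l with
  | nil => rfl
  | cons q l ih => simp only [List.cons_append, vfWord_cons, ih]

variable {Vf}

/-- Derivatives along a smooth vector field preserve smoothness on an open set. [folklore] -/
theorem ContDiffOn.fderiv_apply_vectorField {O : Set (Fin d → ℝ)} (hO : IsOpen O)
    {W : (Fin d → ℝ) → (Fin d → ℝ)} (hW : ContDiffOn ℝ ∞ W O) {F : (Fin d → ℝ) → ℂ}
    (hF : ContDiffOn ℝ ∞ F O) : ContDiffOn ℝ ∞ (fun x ↦ fderiv ℝ F x (W x)) O := by
  have h1 : ContDiffOn ℝ ∞ (fderiv ℝ F) O := hF.fderiv_of_isOpen hO (by simp)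
  exact h1.clm_apply hW

/-- Words along smooth fields of functions smooth on an open set are smooth there. [folklore] -/
theorem contDiffOn_vfWord {O : Set (Fin d → ℝ)} (hO : IsOpen O) (hVf : ∀ p, ContDiffOn ℝ ∞ (Vf p) O)
    (l : List κ) {F : (Fin d → ℝ) → ℂ} (hF : ContDiffOn ℝ ∞ F O) : ContDiffOn ℝ ∞ (vfWord Vf l F) O := by
  induction l with
  | nil => simpa using hF
  | cons p l ih => exact ContDiffOn.fderiv_apply_vectorField hO (hVf p) ih

end Words

/-! ## 2. The coframe of a frame -/

section Coframe

variable (Vf : Fin d → (Fin d → ℝ) → (Fin d → ℝ))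

/-- The frame map `Φ(y) : v ↦ ∑_p v_p V_p(y)`, an endomorphism of `ℝ^d` depending on `y`.
[folklore] -/
def frameMap (y : Fin d → ℝ) : (Fin d → ℝ) →L[ℝ] (Fin d → ℝ) :=
  ∑ p, (ContinuousLinearMap.proj p : (Fin d → ℝ) →L[ℝ] ℝ).smulRight (Vf p y)

/-- `Φ(y) v = ∑_p v_p V_p(y)`. [folklore] -/
theorem frameMap_apply (y v : Fin d → ℝ) : frameMap Vf y v = ∑ p, v p • Vf p y := by
  simp [frameMap]

/-- If `V_p(0) = e_p` then `Φ(0) = 1`. [folklore] -/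
theorem frameMap_zero (h0 : ∀ p, Vf p 0 = Pi.single p 1) : frameMap Vf 0 = 1 := by
  ext v i
  change (frameMap Vf 0 v) i = v i
  rw [frameMap_apply]
  simp only [h0, Finset.sum_apply, Pi.smul_apply, Pi.single_apply, smul_eq_mul, mul_ite, mul_one,
    mul_zero, Finset.sum_ite_eq, Finset.mem_univ, if_true]

variable {Vf}

/-- `Φ` is smooth where the fields are. [folklore] -/
theorem contDiffOn_frameMap {O : Set (Fin d → ℝ)} (hVf : ∀ p, ContDiffOn ℝ ∞ (Vf p) O) :
    ContDiffOn ℝ ∞ (frameMap Vf) O := by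
  unfold frameMap
  refine ContDiffOn.sum fun p _ ↦ ?_
  exact ((ContinuousLinearMap.smulRightL ℝ (Fin d → ℝ) (Fin d → ℝ)
    (ContinuousLinearMap.proj p : (Fin d → ℝ) →L[ℝ] ℝ)).contDiff).comp_contDiffOn (hVf p)

/-- **A radius on which the coframe exists and is smooth.** For fields smooth on the ball
`‖y‖ < R₀` whose frame map at `0` is invertible (e.g. `V_p(0) = e_p`, or any basis) there is
`R₁ ∈ (0, R₀]` such that on the ball `‖y‖ < R₁` the map `Φ(y)` is invertible,
`Ψ = Ring.inverse ∘ Φ` is smooth and `Φ(y) (Ψ(y) v) = v`. [folklore] -/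
theorem exists_coframeRadius {R₀ : ℝ} (hR₀ : 0 < R₀) (hVf : ∀ p, ContDiffOn ℝ ∞ (Vf p) (ball 0 R₀))
    (h0 : IsUnit (frameMap Vf 0)) :
    ∃ R₁ : ℝ, 0 < R₁ ∧ R₁ ≤ R₀ ∧
      ContDiffOn ℝ ∞ (fun y ↦ Ring.inverse (frameMap Vf y)) (ball 0 R₁) ∧
      ∀ y ∈ ball (0 : Fin d → ℝ) R₁, ∀ v, frameMap Vf y (Ring.inverse (frameMap Vf y) v) = v := by
  obtain ⟨u₀, hu₀⟩ := h0
  have hΦ : ContDiffOn ℝ ∞ (frameMap Vf) (ball 0 R₀) := contDiffOn_frameMap hVf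
  -- the normalised frame map `Θ(y) = Φ(0)⁻¹ Φ(y)`, equal to `1` at `0`
  set Θ : (Fin d → ℝ) → (Fin d → ℝ) →L[ℝ] (Fin d → ℝ) := fun y ↦
    ((u₀⁻¹ : ((Fin d → ℝ) →L[ℝ] (Fin d → ℝ))ˣ) : (Fin d → ℝ) →L[ℝ] (Fin d → ℝ)) * frameMap Vf y with hΘ
  have hΘc : ContinuousOn Θ (ball 0 R₀) := continuousOn_const.mul hΦ.continuousOn
  have hΘ0 : Θ 0 = 1 := by
    show ((u₀⁻¹ : ((Fin d → ℝ) →L[ℝ] (Fin d → ℝ))ˣ) : (Fin d → ℝ) →L[ℝ] (Fin d → ℝ)) * frameMap Vf 0 = 1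
    rw [← hu₀, Units.inv_mul]
  -- the open set where `‖1 - Θ‖ < 1/2`
  have hopen : IsOpen (ball (0 : Fin d → ℝ) R₀ ∩ Θ ⁻¹' ball (1 : (Fin d → ℝ) →L[ℝ] (Fin d → ℝ)) (1 / 2)) :=
    hΘc.isOpen_inter_preimage isOpen_ball isOpen_ball
  have hmem : (0 : Fin d → ℝ) ∈ ball (0 : Fin d → ℝ) R₀ ∩ Θ ⁻¹' ball 1 (1 / 2) :=
    ⟨mem_ball_self hR₀, by simp [hΘ0]⟩
  obtain ⟨R₁, hR₁, hball⟩ := Metric.isOpen_iff.1 hopen 0 hmem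
  set r : ℝ := min R₁ R₀ with hr
  have hr0 : 0 < r := lt_min hR₁ hR₀
  have hrR₀ : r ≤ R₀ := min_le_right _ _
  have hrball : ball (0 : Fin d → ℝ) r ⊆ ball (0 : Fin d → ℝ) R₀ ∩ Θ ⁻¹' ball 1 (1 / 2) :=
    (ball_subset_ball (min_le_left _ _)).trans hball
  have hnorm : ∀ y ∈ ball (0 : Fin d → ℝ) r, ‖(1 : (Fin d → ℝ) →L[ℝ] (Fin d → ℝ)) - Θ y‖ < 1 := by
    intro y hy
    have := (hrball hy).2
    rw [Set.mem_preimage, mem_ball, dist_eq_norm, ← norm_neg, neg_sub] at this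
    exact this.trans (by norm_num)
  -- `Φ y = Φ 0 · Θ y` is a unit on the small ball
  have hunit : ∀ y ∈ ball (0 : Fin d → ℝ) r, ∃ u : ((Fin d → ℝ) →L[ℝ] (Fin d → ℝ))ˣ,
      (u : (Fin d → ℝ) →L[ℝ] (Fin d → ℝ)) = frameMap Vf y := by
    intro y hy
    refine ⟨u₀ * Units.oneSub _ (hnorm y hy), ?_⟩
    rw [Units.val_mul, Units.val_oneSub, sub_sub_cancel, hΘ, ← mul_assoc, Units.mul_inv, one_mul]
  refine ⟨r, hr0, hrR₀, ?_, ?_⟩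
  · intro y hy
    obtain ⟨u, hu⟩ := hunit y hy
    have h1 : ContDiffAt ℝ ∞ Ring.inverse (frameMap Vf y) := by
      rw [← hu]
      exact contDiffAt_ringInverse ℝ u
    exact h1.comp_contDiffWithinAt y ((hΦ y (hrball hy).1).mono (ball_subset_ball hrR₀))
  · intro y hy v
    obtain ⟨u, hu⟩ := hunit y hy
    have hU : IsUnit (frameMap Vf y) := ⟨u, hu⟩
    have := Ring.mul_inverse_cancel _ hU
    have h := congrArg (fun T : (Fin d → ℝ) →L[ℝ] (Fin d → ℝ) ↦ T v) this
    simpa using h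

/-- If `V_p(0) = e_p` the frame map at `0` is the identity, hence a unit. [folklore] -/
theorem isUnit_frameMap_zero (h0 : ∀ p, Vf p 0 = Pi.single p 1) : IsUnit (frameMap Vf 0) := by
  rw [frameMap_zero Vf h0]
  exact isUnit_one

/-- **The frame expansion of a derivative**: `DF(y)[v] = ∑_p (Ψ(y) v)_p · (V_p F)(y)` whenever
`Φ(y) (Ψ(y) v) = v`. [folklore] -/
theorem fderiv_apply_eq_sum_coframe {y : Fin d → ℝ} {Ψy : (Fin d → ℝ) →L[ℝ] (Fin d → ℝ)}
    (hΨ : ∀ v, frameMap Vf y (Ψy v) = v) (F : (Fin d → ℝ) → ℂ) (v : Fin d → ℝ) :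
    fderiv ℝ F y v = ∑ p, ((Ψy v p : ℝ) : ℂ) * vfWord Vf [p] F y := by
  conv_lhs => rw [← hΨ v, frameMap_apply]
  rw [map_sum]
  refine Finset.sum_congr rfl fun p _ ↦ ?_
  rw [map_smul, vfWord_cons, vfWord_nil, Complex.real_smul]

end Coframe

/-! ## 3. Iterated derivatives through frame words -/

section Conversion

variable (Vf : Fin d → (Fin d → ℝ) → (Fin d → ℝ))

/-- The word sum `S_j(F, x) = ∑_{k ≤ j} ∑_{w : Fin k → Fin d} ‖(V_{w} F)(x)‖` over all frame words of
length `≤ j` (indexed as in `NelsonInteriorEstimate`: `List.ofFn w`). [folklore] -/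
def wordSum (j : ℕ) (F : (Fin d → ℝ) → ℂ) (x : Fin d → ℝ) : ℝ :=
  ∑ k ∈ Finset.range (j + 1), ∑ w : Fin k → Fin d, ‖vfWord Vf (List.ofFn w) F x‖

/-- `0 ≤ S_j`. [folklore] -/
theorem wordSum_nonneg (j : ℕ) (F : (Fin d → ℝ) → ℂ) (x : Fin d → ℝ) : 0 ≤ wordSum Vf j F x :=
  Finset.sum_nonneg fun _ _ ↦ Finset.sum_nonneg fun _ _ ↦ norm_nonneg _

/-- `S_0(F, x) = ‖F x‖`. [folklore] -/
theorem wordSum_zero (F : (Fin d → ℝ) → ℂ) (x : Fin d → ℝ) : wordSum Vf 0 F x = ‖F x‖ := by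
  simp [wordSum]

/-- `S_j ≤ S_{j'}` for `j ≤ j'`. [folklore] -/
theorem wordSum_mono {j j' : ℕ} (h : j ≤ j') (F : (Fin d → ℝ) → ℂ) (x : Fin d → ℝ) :
    wordSum Vf j F x ≤ wordSum Vf j' F x :=
  Finset.sum_le_sum_of_subset_of_nonneg (Finset.range_mono (by omega))
    fun _ _ _ ↦ Finset.sum_nonneg fun _ _ ↦ norm_nonneg _

/-- `List.ofFn (Fin.snoc w p) = List.ofFn w ++ [p]`. [folklore] -/
theorem ofFn_snoc {k : ℕ} (w : Fin k → Fin d) (p : Fin d) :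
    List.ofFn (Fin.snoc w p : Fin (k + 1) → Fin d) = List.ofFn w ++ [p] := by
  rw [List.ofFn_succ', List.concat_eq_append]
  simp

/-- The slice `q = p` of the sum over words of length `k + 1`. [folklore] -/
theorem sum_snoc_le_sum {k : ℕ} (g : (Fin (k + 1) → Fin d) → ℝ) (hg : ∀ w, 0 ≤ g w) (p : Fin d) :
    ∑ w : Fin k → Fin d, g (Fin.snoc w p) ≤ ∑ w' : Fin (k + 1) → Fin d, g w' := by
  have e := Fintype.sum_equiv (Fin.snocEquiv fun _ : Fin (k + 1) ↦ Fin d)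
    (fun q : Fin d × (Fin k → Fin d) ↦ g (Fin.snoc q.2 q.1)) g (fun _ ↦ rfl)
  rw [← e, Fintype.sum_prod_type]
  exact Finset.single_le_sum (f := fun q : Fin d ↦ ∑ w : Fin k → Fin d, g (Fin.snoc w q))
    (fun q _ ↦ Finset.sum_nonneg fun w _ ↦ hg _) (Finset.mem_univ p)

/-- **Re-indexing**: `S_j(V_p F, x) ≤ S_{j+1}(F, x)` (a word applied to `V_p F` is a longer word
applied to `F`). [folklore] -/
theorem wordSum_vfWord_singleton_le (j : ℕ) (p : Fin d) (F : (Fin d → ℝ) → ℂ) (x : Fin d → ℝ) :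
    wordSum Vf j (vfWord Vf [p] F) x ≤ wordSum Vf (j + 1) F x := by
  unfold wordSum
  have hstep : ∀ k, ∑ w : Fin k → Fin d, ‖vfWord Vf (List.ofFn w) (vfWord Vf [p] F) x‖ ≤
      ∑ w' : Fin (k + 1) → Fin d, ‖vfWord Vf (List.ofFn w') F x‖ := by
    intro k
    have e : ∀ w : Fin k → Fin d, vfWord Vf (List.ofFn w) (vfWord Vf [p] F) =
        vfWord Vf (List.ofFn (Fin.snoc w p : Fin (k + 1) → Fin d)) F := by
      intro w
      rw [ofFn_snoc, vfWord_append_singleton]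
    simp only [e]
    exact sum_snoc_le_sum (fun w' ↦ ‖vfWord Vf (List.ofFn w') F x‖) (fun _ ↦ norm_nonneg _) p
  calc ∑ k ∈ Finset.range (j + 1), ∑ w : Fin k → Fin d, ‖vfWord Vf (List.ofFn w) (vfWord Vf [p] F) x‖
      ≤ ∑ k ∈ Finset.range (j + 1), ∑ w' : Fin (k + 1) → Fin d, ‖vfWord Vf (List.ofFn w') F x‖ :=
        Finset.sum_le_sum fun k _ ↦ hstep k
    _ = ∑ k ∈ (Finset.range (j + 1)).map ⟨Nat.succ, Nat.succ_injective⟩,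
          ∑ w' : Fin k → Fin d, ‖vfWord Vf (List.ofFn w') F x‖ := by
        rw [Finset.sum_map]
        rfl
    _ ≤ ∑ k ∈ Finset.range (j + 1 + 1), ∑ w' : Fin k → Fin d, ‖vfWord Vf (List.ofFn w') F x‖ := by
        refine Finset.sum_le_sum_of_subset_of_nonneg ?_ fun _ _ _ ↦
          Finset.sum_nonneg fun _ _ ↦ norm_nonneg _
        intro k hk
        simp only [Finset.mem_map, Finset.mem_range, Function.Embedding.coeFn_mk] at hk
        obtain ⟨a, ha, rfl⟩ := hk
        exact Finset.mem_range.2 (by omega)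

variable {Vf}

/-- The coefficient functionals `T ↦ ((T v)_p : ℂ)` have norm `≤ ‖v‖`. [folklore] -/
theorem norm_coeffCLM_le (p : Fin d) (v : Fin d → ℝ) :
    ‖(Complex.ofRealCLM.comp ((ContinuousLinearMap.proj p : (Fin d → ℝ) →L[ℝ] ℝ).comp
      (ContinuousLinearMap.apply ℝ (Fin d → ℝ) v)))‖ ≤ ‖v‖ := by
  refine ContinuousLinearMap.opNorm_le_bound _ (norm_nonneg v) fun T ↦ ?_
  simp only [ContinuousLinearMap.coe_comp, Function.comp_apply, ContinuousLinearMap.apply_apply,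
    ContinuousLinearMap.proj_apply, Complex.ofRealCLM_apply, Complex.norm_real]
  calc ‖T v p‖ ≤ ‖T v‖ := norm_le_pi_norm (T v) p
    _ ≤ ‖T‖ * ‖v‖ := T.le_opNorm v
    _ = ‖v‖ * ‖T‖ := mul_comm _ _

/-- **Iterated derivatives through frame words.** On the ball `‖y‖ < R₁` let the frame fields
`V_p` and the coframe `Ψ = Ring.inverse ∘ Φ` be smooth with `Φ(y)(Ψ(y) v) = v`. Then for every
`j` there is `C` such that for every function `F` smooth on the ball and every `x` with
`‖x‖ ≤ ρ < R₁`, `‖D^i F (x)‖ ≤ C S_i(F, x)` for all `i ≤ j` (derivatives within the ball).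
Induction on `j`: `D^{j+1} F (x)(m) = D^j (y ↦ DF(y)[v]) (x)(init m)` with `v = m_last`, and
`DF[v] = ∑_p (Ψ v)_p · V_p F` on the ball; Leibniz, the bound `‖D^i ((Ψ · v)_p)‖ ≤ ‖v‖ sup ‖D^i Ψ‖`
and the induction hypothesis for `V_p F`. [folklore] -/
theorem exists_norm_iteratedFDerivWithin_le_wordSum {R₁ : ℝ}
    (hVf : ∀ p, ContDiffOn ℝ ∞ (Vf p) (ball 0 R₁))
    (hΨs : ContDiffOn ℝ ∞ (fun y ↦ Ring.inverse (frameMap Vf y)) (ball 0 R₁))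
    (hΨ : ∀ y ∈ ball (0 : Fin d → ℝ) R₁, ∀ v, frameMap Vf y (Ring.inverse (frameMap Vf y) v) = v)
    {ρ : ℝ} (hρ : ρ < R₁) (j : ℕ) :
    ∃ C : ℝ, 0 ≤ C ∧ ∀ i ≤ j, ∀ (F : (Fin d → ℝ) → ℂ), ContDiffOn ℝ ∞ F (ball 0 R₁) →
      ∀ x ∈ closedBall (0 : Fin d → ℝ) ρ,
        ‖iteratedFDerivWithin ℝ i F (ball 0 R₁) x‖ ≤ C * wordSum Vf i F x := by
  set s : Set (Fin d → ℝ) := ball 0 R₁ with hs_def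
  set Ψ : (Fin d → ℝ) → (Fin d → ℝ) →L[ℝ] (Fin d → ℝ) := fun y ↦ Ring.inverse (frameMap Vf y) with hΨ_def
  have hs : UniqueDiffOn ℝ s := isOpen_ball.uniqueDiffOn
  have hKs : closedBall (0 : Fin d → ℝ) ρ ⊆ s := closedBall_subset_ball hρ
  have hK : IsCompact (closedBall (0 : Fin d → ℝ) ρ) := isCompact_closedBall _ _
  -- uniform bounds for the derivatives of `Ψ` on the compact ball
  have hMex : ∀ j : ℕ, ∃ M : ℝ, 0 ≤ M ∧ ∀ i ≤ j, ∀ x ∈ closedBall (0 : Fin d → ℝ) ρ,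
      ‖iteratedFDerivWithin ℝ i Ψ s x‖ ≤ M := by
    intro j
    have h : ∀ i : ℕ, ∃ M, ∀ x ∈ closedBall (0 : Fin d → ℝ) ρ, ‖iteratedFDerivWithin ℝ i Ψ s x‖ ≤ M :=
      fun i ↦ hK.exists_bound_of_continuousOn
        ((hΨs.continuousOn_iteratedFDerivWithin (m := i) (by exact_mod_cast le_top) hs).mono hKs)
    choose M hM using h
    refine ⟨∑ i ∈ Finset.range (j + 1), max (M i) 0, Finset.sum_nonneg fun i _ ↦ le_max_right _ _,
      fun i hi x hx ↦ (hM i x hx).trans ((le_max_left (M i) 0).trans ?_)⟩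
    exact Finset.single_le_sum (f := fun i ↦ max (M i) 0) (fun i _ ↦ le_max_right _ _)
      (Finset.mem_range.2 (by omega))
  induction j with
  | zero =>
    refine ⟨1, zero_le_one, fun i hi F _ x _ ↦ ?_⟩
    obtain rfl : i = 0 := Nat.le_zero.mp hi
    rw [norm_iteratedFDerivWithin_zero, wordSum_zero, one_mul]
  | succ j ih =>
    obtain ⟨C, hC0, hC⟩ := ih
    obtain ⟨M, hM0, hM⟩ := hMex j
    -- the constant for order `j + 1`
    set C' : ℝ := d * (∑ i ∈ Finset.range (j + 1), (j.choose i : ℝ)) * M * C with hC'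
    have hC'0 : 0 ≤ C' := by positivity
    refine ⟨max C C', le_max_of_le_left hC0, fun i hi F hF x hx ↦ ?_⟩
    by_cases hij : i ≤ j
    · exact (hC i hij F hF x hx).trans
        (mul_le_mul_of_nonneg_right (le_max_left _ _) (wordSum_nonneg Vf i F x))
    obtain rfl : i = j + 1 := by omega
    have hxs : x ∈ s := hKs hx
    refine le_trans ?_ (mul_le_mul_of_nonneg_right (le_max_right C C') (wordSum_nonneg Vf _ F x))
    -- the pieces `G_p = V_p F` and the coefficients `c_p^v = (Ψ v)_p`
    set G : Fin d → (Fin d → ℝ) → ℂ := fun p ↦ vfWord Vf [p] F with hG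
    have hGs : ∀ p, ContDiffOn ℝ ∞ (G p) s := fun p ↦ contDiffOn_vfWord isOpen_ball hVf [p] hF
    set L : Fin d → (Fin d → ℝ) → ((Fin d → ℝ) →L[ℝ] (Fin d → ℝ)) →L[ℝ] ℂ := fun p v ↦
      Complex.ofRealCLM.comp ((ContinuousLinearMap.proj p : (Fin d → ℝ) →L[ℝ] ℝ).comp
        (ContinuousLinearMap.apply ℝ (Fin d → ℝ) v)) with hL
    have hLΨ : ∀ p v y, (L p v ∘ Ψ) y = ((Ψ y v p : ℝ) : ℂ) := fun p v y ↦ rfl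
    have hcs : ∀ p v, ContDiffOn ℝ ∞ (L p v ∘ Ψ) s := fun p v ↦ (L p v).contDiff.comp_contDiffOn hΨs
    -- bound of the derivatives of order `≤ j` of the coefficients
    have hcoef : ∀ p v, ∀ i ≤ j, ‖iteratedFDerivWithin ℝ i (L p v ∘ Ψ) s x‖ ≤ ‖v‖ * M := by
      intro p v i hi
      calc ‖iteratedFDerivWithin ℝ i (L p v ∘ Ψ) s x‖ ≤ ‖L p v‖ * ‖iteratedFDerivWithin ℝ i Ψ s x‖ :=
            (L p v).norm_iteratedFDerivWithin_comp_left (hΨs x hxs) hs hxs (by exact_mod_cast le_top)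
        _ ≤ ‖v‖ * M := mul_le_mul (norm_coeffCLM_le p v) (hM i hi x hx) (norm_nonneg _) (norm_nonneg _)
    -- bound of the derivatives of order `≤ j` of the pieces, by induction
    have hpiece : ∀ p, ∀ i ≤ j, ‖iteratedFDerivWithin ℝ i (G p) s x‖ ≤ C * wordSum Vf (j + 1) F x := by
      intro p i hi
      calc ‖iteratedFDerivWithin ℝ i (G p) s x‖ ≤ C * wordSum Vf i (G p) x := hC i hi (G p) (hGs p) x hx
        _ ≤ C * wordSum Vf j (G p) x := mul_le_mul_of_nonneg_left (wordSum_mono Vf hi _ x) hC0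
        _ ≤ C * wordSum Vf (j + 1) F x :=
            mul_le_mul_of_nonneg_left (wordSum_vfWord_singleton_le Vf j p F x) hC0
    -- the scalar functions `g_v = DF[v]` and their expansion on `s`
    have hexp : ∀ v, EqOn (fun y ↦ fderivWithin ℝ F s y v)
        (fun y ↦ ∑ p, (L p v ∘ Ψ) y * G p y) s := by
      intro v y hy
      simp only [hLΨ, hG]
      rw [fderivWithin_of_isOpen isOpen_ball hy]
      exact fderiv_apply_eq_sum_coframe (hΨ y hy) F v
    have hgv : ∀ v, ‖iteratedFDerivWithin ℝ j (fun y ↦ fderivWithin ℝ F s y v) s x‖ ≤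
        (d * (∑ i ∈ Finset.range (j + 1), (j.choose i : ℝ)) * M * C) * ‖v‖ * wordSum Vf (j + 1) F x := by
      intro v
      rw [iteratedFDerivWithin_congr (hexp v) hxs]
      have hsumfn : (fun y ↦ ∑ p, (L p v ∘ Ψ) y * G p y) = ∑ p, fun y ↦ (L p v ∘ Ψ) y * G p y := by
        funext y; simp only [Finset.sum_apply]
      rw [hsumfn, iteratedFDerivWithin_sum_apply hs hxs fun p _ ↦
        (((hcs p v).mul (hGs p)).contDiffWithinAt hxs).of_le (by exact_mod_cast le_top)]
      refine (norm_sum_le _ _).trans ?_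
      have hterm : ∀ p, ‖iteratedFDerivWithin ℝ j (fun y ↦ (L p v ∘ Ψ) y * G p y) s x‖ ≤
          (∑ i ∈ Finset.range (j + 1), (j.choose i : ℝ)) * (‖v‖ * M) * (C * wordSum Vf (j + 1) F x) := by
        intro p
        refine (norm_iteratedFDerivWithin_mul_le (hcs p v) (hGs p) hs hxs (n := j)
          (by exact_mod_cast le_top)).trans ?_
        rw [Finset.sum_mul, Finset.sum_mul]
        refine Finset.sum_le_sum fun i hi ↦ ?_
        have hi' : i ≤ j := Nat.lt_succ_iff.mp (Finset.mem_range.mp hi)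
        have hji : j - i ≤ j := Nat.sub_le j i
        exact mul_le_mul (mul_le_mul_of_nonneg_left (hcoef p v i hi') (by positivity))
          (hpiece p (j - i) hji) (norm_nonneg _) (by positivity)
      calc ∑ p, ‖iteratedFDerivWithin ℝ j (fun y ↦ (L p v ∘ Ψ) y * G p y) s x‖
          ≤ ∑ _p : Fin d, (∑ i ∈ Finset.range (j + 1), (j.choose i : ℝ)) * (‖v‖ * M) *
              (C * wordSum Vf (j + 1) F x) := Finset.sum_le_sum fun p _ ↦ hterm p
        _ = _ := by simp only [Finset.sum_const, Finset.card_univ, Fintype.card_fin, nsmul_eq_mul]; ring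
    -- the operator norm of the derivative of order `j + 1`
    have hFj : ContDiffOn ℝ ∞ (fun y ↦ fderivWithin ℝ F s y) s := hF.fderivWithin hs (by simp)
    refine ContinuousMultilinearMap.opNorm_le_bound (mul_nonneg hC'0 (wordSum_nonneg Vf _ F x))
      fun m ↦ ?_
    rw [iteratedFDerivWithin_succ_apply_right hs hxs m,
      ← iteratedFDerivWithin_clm_apply_const_apply hs hFj (by exact_mod_cast le_top) hxs]
    refine (ContinuousMultilinearMap.le_opNorm _ _).trans ?_
    have hv := hgv (m (Fin.last j))
    calc ‖iteratedFDerivWithin ℝ j (fun y ↦ fderivWithin ℝ F s y (m (Fin.last j))) s x‖ *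
          ∏ i : Fin j, ‖Fin.init m i‖
        ≤ (C' * ‖m (Fin.last j)‖ * wordSum Vf (j + 1) F x) * ∏ i : Fin j, ‖Fin.init m i‖ :=
          mul_le_mul_of_nonneg_right (by rw [hC']; exact hv) (Finset.prod_nonneg fun i _ ↦ norm_nonneg _)
      _ = C' * wordSum Vf (j + 1) F x * ∏ i : Fin (j + 1), ‖m i‖ := by
          rw [Fin.prod_univ_castSucc]
          simp only [Fin.init]
          ring

end Conversion

/-! ## 4. The frame Sobolev bound -/

section Final

variable {Vf : Fin d → (Fin d → ℝ) → (Fin d → ℝ)}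

/-- Cauchy–Schwarz on a set of finite measure for a function continuous there:
`∫_K ‖h‖ ≤ (vol K)^{1/2} (∫_K ‖h‖²)^{1/2}`. [folklore] -/
theorem setIntegral_norm_le_sqrt_vol_mul {K : Set (Fin d → ℝ)} (hK : IsCompact K) {h : (Fin d → ℝ) → ℂ}
    (hh : ContinuousOn h K) :
    ∫ x in K, ‖h x‖ ≤ volume.real K ^ (1 / 2 : ℝ) * (∫ x in K, ‖h x‖ ^ (2 : ℝ)) ^ (1 / 2 : ℝ) := by
  have hKm : MeasurableSet K := hK.isClosed.measurableSet
  haveI : Fact (volume K < (⊤ : ℝ≥0∞)) := ⟨hK.measure_lt_top⟩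
  obtain ⟨B, hB⟩ := hK.exists_bound_of_continuousOn hh
  have hmeas : AEStronglyMeasurable h (volume.restrict K) := hh.aestronglyMeasurable hKm
  have hmem : MemLp h (ENNReal.ofReal 2) (volume.restrict K) := by
    rw [show ENNReal.ofReal 2 = 2 by norm_num]
    exact MemLp.of_bound hmeas B ((ae_restrict_iff' hKm).2 (Eventually.of_forall hB))
  have hone : MemLp (fun _ : Fin d → ℝ ↦ (1 : ℂ)) (ENNReal.ofReal 2) (volume.restrict K) := memLp_const 1
  have hCS := integral_mul_norm_le_Lp_mul_Lq (μ := volume.restrict K) Real.HolderConjugate.two_two hone hmem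
  simp only [norm_one, one_mul, Real.one_rpow, integral_const, smul_eq_mul, mul_one] at hCS
  simpa using hCS

/-- **The frame Sobolev bound.** Let `(V_p)_{p < d}` be vector fields smooth on the ball
`‖y‖ < R₀` of `ℝ^d` whose frame map at `0` is invertible (a frame near `0`). There is `ρ₀ ∈ (0, R₀)` such that for
every `0 < ρ ≤ ρ₀` there is `C ≥ 0` with

  `‖F 0‖ ≤ C ∑_{k ≤ d} ∑_{w : Fin k → Fin d} (∫_{‖x‖ ≤ ρ} ‖(V_{w 0} ⋯ V_{w (k-1)} F)(x)‖² dx)^{1/2}`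

for every smooth `F : ℝ^d → ℂ` — the point value through the `L²`-norms of the frame words of
length `≤ d` on an arbitrarily small ball (the Sobolev point bound
`exists_norm_apply_zero_le_sum_setIntegral` with a bump function, the conversion
`exists_norm_iteratedFDerivWithin_le_wordSum`, and Cauchy–Schwarz). Nelson 1959, §6 (the
pointwise conclusion of the `L²`-estimates). [folklore] -/
theorem exists_frame_pointBound {R₀ : ℝ} (hR₀ : 0 < R₀) (hVf : ∀ p, ContDiffOn ℝ ∞ (Vf p) (ball 0 R₀))
    (h0 : IsUnit (frameMap Vf 0)) :
    ∃ ρ₀ : ℝ, 0 < ρ₀ ∧ ρ₀ < R₀ ∧ ∀ ρ : ℝ, 0 < ρ → ρ ≤ ρ₀ → ∃ C : ℝ, 0 ≤ C ∧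
      ∀ (F : (Fin d → ℝ) → ℂ), ContDiff ℝ ∞ F →
        ‖F 0‖ ≤ C * ∑ k ∈ Finset.range (d + 1), ∑ w : Fin k → Fin d,
          (∫ x in closedBall (0 : Fin d → ℝ) ρ, ‖vfWord Vf (List.ofFn w) F x‖ ^ (2 : ℝ)) ^ (1 / 2 : ℝ) := by
  obtain ⟨R₁, hR₁, hR₁R₀, hΨs, hΨ⟩ := exists_coframeRadius hR₀ hVf h0
  have hVf₁ : ∀ p, ContDiffOn ℝ ∞ (Vf p) (ball 0 R₁) := fun p ↦ (hVf p).mono (ball_subset_ball hR₁R₀)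
  refine ⟨R₁ / 2, by positivity, by linarith, fun ρ hρ hρR ↦ ?_⟩
  have hρR₁ : ρ < R₁ := by linarith
  -- the bump function
  let θ : ContDiffBump (0 : Fin d → ℝ) := ⟨ρ / 2, ρ, by positivity, by linarith⟩
  have hθs : ContDiff ℝ ∞ (θ : (Fin d → ℝ) → ℝ) := θ.contDiff
  have hθc : HasCompactSupport (θ : (Fin d → ℝ) → ℝ) := θ.hasCompactSupport
  have hθ0 : (θ : (Fin d → ℝ) → ℝ) 0 = 1 := θ.one_of_mem_closedBall (mem_closedBall_self (by positivity))
  have hθsupp : tsupport (θ : (Fin d → ℝ) → ℝ) = closedBall 0 ρ := θ.tsupport_eq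
  obtain ⟨C₁, hC₁0, hC₁⟩ := exists_norm_apply_zero_le_sum_setIntegral hθs hθc hθ0
  obtain ⟨C₂, hC₂0, hC₂⟩ := exists_norm_iteratedFDerivWithin_le_wordSum hVf₁ hΨs hΨ hρR₁ d
  set K : Set (Fin d → ℝ) := closedBall 0 ρ with hK_def
  have hK : IsCompact K := isCompact_closedBall _ _
  have hKs : K ⊆ ball 0 R₁ := closedBall_subset_ball hρR₁
  set Vol : ℝ := volume.real K ^ (1 / 2 : ℝ) with hVol
  have hVol0 : 0 ≤ Vol := by positivity
  refine ⟨C₁ * (d + 1) * (C₂ * Vol), by positivity, fun F hF ↦ ?_⟩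
  have hFs : ContDiffOn ℝ ∞ F (ball 0 R₁) := hF.contDiffOn
  -- words are continuous on `K`
  have hwc : ∀ (k : ℕ) (w : Fin k → Fin d), ContinuousOn (vfWord Vf (List.ofFn w) F) K := fun k w ↦
    ((contDiffOn_vfWord isOpen_ball hVf₁ _ hFs).continuousOn).mono hKs
  set W : ℝ := ∑ k ∈ Finset.range (d + 1), ∑ w : Fin k → Fin d,
    (∫ x in K, ‖vfWord Vf (List.ofFn w) F x‖ ^ (2 : ℝ)) ^ (1 / 2 : ℝ) with hW
  have hW0 : 0 ≤ W := Finset.sum_nonneg fun _ _ ↦ Finset.sum_nonneg fun _ _ ↦ by positivity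
  -- each `∫_K ‖D^j F‖` is bounded by `C₂ Vol W`
  have hj : ∀ j ∈ Finset.range (d + 1), ∫ x in K, ‖iteratedFDeriv ℝ j F x‖ ≤ C₂ * Vol * W := by
    intro j hj
    have hj' : j ≤ d := Nat.lt_succ_iff.mp (Finset.mem_range.mp hj)
    -- pointwise conversion on `K`
    have hpt : ∀ x ∈ K, ‖iteratedFDeriv ℝ j F x‖ ≤ C₂ * wordSum Vf d F x := by
      intro x hx
      rw [← iteratedFDerivWithin_of_isOpen j isOpen_ball (hKs hx)]
      exact (hC₂ j hj' F hFs x hx).trans (mul_le_mul_of_nonneg_left (wordSum_mono Vf hj' F x) hC₂0)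
    have hint1 : IntegrableOn (fun x ↦ ‖iteratedFDeriv ℝ j F x‖) K :=
      ((hF.continuous_iteratedFDeriv (m := j) (by exact_mod_cast le_top)).norm).continuousOn.integrableOn_compact hK
    have hint2 : IntegrableOn (fun x ↦ C₂ * wordSum Vf d F x) K := by
      refine ContinuousOn.integrableOn_compact hK (continuousOn_const.mul ?_)
      unfold wordSum
      exact continuousOn_finsetSum _ fun k _ ↦ continuousOn_finsetSum _ fun w _ ↦ (hwc k w).norm
    calc ∫ x in K, ‖iteratedFDeriv ℝ j F x‖ ≤ ∫ x in K, C₂ * wordSum Vf d F x :=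
          setIntegral_mono_on hint1 hint2 hK.isClosed.measurableSet hpt
      _ = C₂ * ∑ k ∈ Finset.range (d + 1), ∑ w : Fin k → Fin d,
            ∫ x in K, ‖vfWord Vf (List.ofFn w) F x‖ := by
          rw [integral_const_mul]
          unfold wordSum
          rw [integral_finsetSum _ fun k _ ↦ ?_]
          · refine congrArg _ (Finset.sum_congr rfl fun k _ ↦ ?_)
            exact integral_finsetSum _ fun w _ ↦ ((hwc k w).norm).integrableOn_compact hK
          · exact integrable_finsetSum _ fun w _ ↦ ((hwc k w).norm).integrableOn_compact hK
      _ ≤ C₂ * ∑ k ∈ Finset.range (d + 1), ∑ w : Fin k → Fin d,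
            Vol * (∫ x in K, ‖vfWord Vf (List.ofFn w) F x‖ ^ (2 : ℝ)) ^ (1 / 2 : ℝ) := by
          refine mul_le_mul_of_nonneg_left (Finset.sum_le_sum fun k _ ↦ Finset.sum_le_sum fun w _ ↦ ?_) hC₂0
          exact setIntegral_norm_le_sqrt_vol_mul hK (hwc k w)
      _ = C₂ * Vol * W := by rw [hW, Finset.mul_sum]; simp only [Finset.mul_sum]; ring_nf
  calc ‖F 0‖ ≤ C₁ * ∑ j ∈ Finset.range (d + 1), ∫ x in tsupport (θ : (Fin d → ℝ) → ℝ), ‖iteratedFDeriv ℝ j F x‖ :=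
        hC₁ F hF
    _ = C₁ * ∑ j ∈ Finset.range (d + 1), ∫ x in K, ‖iteratedFDeriv ℝ j F x‖ := by rw [hθsupp]
    _ ≤ C₁ * ∑ _j ∈ Finset.range (d + 1), C₂ * Vol * W :=
        mul_le_mul_of_nonneg_left (Finset.sum_le_sum hj) hC₁0
    _ = C₁ * (d + 1) * (C₂ * Vol) * W := by
        rw [Finset.sum_const, Finset.card_range, nsmul_eq_mul]; push_cast; ring

end Final

end Literature.Analysis.OperatorTheory
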